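import Mathlib

/-!
# `M Mᵀ = k·I` on `4q + 2` coordinates over a field of characteristic 0 forces `k = u² + v²` in that field; folding over a field

Framing: lottery ticket; floor = certified bounds/negative ranges.

Cell pub-namedobj (venture DiscreteObjects), target (H), hadamard gen 13.  FIELD-GENERAL copies of the `ℚ`-theorems of
`GramTwoSquares` (Raghavarao / Geramita–Seberry two-squares condition, elementary proof by Lagrange + quaternion block + the
Ryser / van Lint–Wilson elimination trick [cite: VanLintWilson2001, Thm 19.11 (proof)]) and of the folding identity of
`InvolutionFolding`, with `ℚ` replaced by an arbitrary field `F` of characteristic `0` (the proofs are verbatim).  Purpose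
(FAMILY-F12-G13 §2, HANDOFF-H-g13 item 1): the obstruction to automorphisms of order `4` with fixed-point-free square lives over
`F = ℚ(√2)` — folding the `√2`-eigenspace of `P + Pᵀ` yields a square `F`-matrix `W` on `334 ≡ 2 (mod 4)` coordinates with
`W Wᵀ = 668·1`, whence `668 = u² + v²` in `ℚ(√2)`, which the companion `SqrtTwoNorm668` refutes.  This file is the reusable,
assumption-free part: `elim_fin_field`, `elim_field`, `dotProduct_mulVec_self_field`, `exists_four_sq_cast`,
`quaternionMatrix_mul_transpose_field`, `sq_add_sq_of_mul_transpose_self_core_field`, **`sq_add_sq_of_mul_transpose_self_field`**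
(`W : Matrix α α F`, `W Wᵀ = k·1`, `k ∈ ℕ`, `|α| ≡ 2 (mod 4)` ⇒ `∃ u v : F, u² + v² = k`), **`folding_gram_field`**
(`H Hᵀ = n`, `P H = H Q`, `Vᵀ V = c • (1 + Q')`-type hypotheses kept abstract: `H Hᵀ = n·1`, `H M = N H`, `Vᵀ V = R`,
`H R Hᵀ = n • S`, `U S Uᵀ = t • 1` ⇒ `(U H Vᵀ)(U H Vᵀ)ᵀ = (n t)·1`).  Ours; no `sorry`.
-/

namespace Summit.Ventures.DiscreteObjects.Hadamard

open Finset BigOperators Matrix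

variable {F : Type*} [Field F] [CharZero F]

section elimination

/-- **Elimination lemma, `Fin m` version** (the Ryser / van Lint–Wilson trick [cite: VanLintWilson2001, Thm 19.11 (proof)]):
if `Σᵢ ((A z)ᵢ + bᵢ)² + Φ z = Σᵢ zᵢ² + c` for all `z : Fin m → F`, then `Φ z = c` for some `z`. -/
theorem elim_fin_field (m : ℕ) : ∀ (A : Matrix (Fin m) (Fin m) F) (b : Fin m → F) (Φ : (Fin m → F) → F) (c : F),
    (∀ z, ∑ i, ((A *ᵥ z) i + b i) ^ 2 + Φ z = ∑ i, z i ^ 2 + c) → ∃ z, Φ z = c := by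
  induction m with
  | zero =>
    intro A b Φ c h
    refine ⟨0, ?_⟩
    simpa using h 0
  | succ m ih =>
    intro A b Φ c h
    classical
    -- expansion of `A (t :: z')` along the first column
    have hmv : ∀ (t : F) (z' : Fin m → F) (i : Fin (m + 1)),
        (A *ᵥ Fin.cons t z') i = A i 0 * t + ∑ j, A i j.succ * z' j := by
      intro t z' i
      simp [mulVec, dotProduct, Fin.sum_univ_succ]
    -- the first form is `c₀ t + d z'`; choose `t = σ z' = γ · d z'` with `c₀ σ + d = ± σ`
    set c₀ : F := A 0 0 with hc₀
    set γ : F := if c₀ = 1 then -(1 / 2) else 1 / (1 - c₀) with hγ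
    set d : (Fin m → F) → F := fun z' => ∑ j, A 0 j.succ * z' j + b 0 with hd
    set σ : (Fin m → F) → F := fun z' => γ * d z' with hσ
    have hkey : ∀ z', ((A *ᵥ Fin.cons (σ z') z') 0 + b 0) ^ 2 = (σ z') ^ 2 := by
      intro z'
      rw [hmv]
      have hval : A 0 0 * σ z' + ∑ j, A 0 j.succ * z' j + b 0 = c₀ * (γ * d z') + d z' := by
        simp only [hσ, hd, hc₀]; ring
      rw [hval]
      by_cases h1 : c₀ = 1
      · have hγ' : γ = -(1 / 2) := by simp [hγ, h1]
        rw [h1, hγ']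
        simp only [hσ, hγ']
        ring
      · have hne : (1 : F) - c₀ ≠ 0 := sub_ne_zero.mpr (Ne.symm h1)
        have hγ' : γ = 1 / (1 - c₀) := by simp [hγ, h1]
        have hlin : c₀ * (γ * d z') + d z' = γ * d z' := by
          rw [hγ']
          field_simp
          ring
        rw [hlin]
    -- the remaining forms restricted to the hyperplane are affine in `z'`
    set A' : Matrix (Fin m) (Fin m) F := fun i j => A i.succ 0 * (γ * A 0 j.succ) + A i.succ j.succ with hA'
    set b' : Fin m → F := fun i => A i.succ 0 * (γ * b 0) + b i.succ with hb'
    have hrow : ∀ z' (i : Fin m), (A *ᵥ Fin.cons (σ z') z') i.succ + b i.succ = (A' *ᵥ z') i + b' i := by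
      intro z' i
      have e1 : (A' *ᵥ z') i = A i.succ 0 * (γ * ∑ j, A 0 j.succ * z' j) + ∑ j, A i.succ j.succ * z' j := by
        simp only [hA', mulVec, dotProduct]
        rw [Finset.mul_sum, Finset.mul_sum, ← Finset.sum_add_distrib]
        exact Finset.sum_congr rfl (fun j _ => by ring)
      rw [hmv, e1]
      simp only [hσ, hd, hb']
      ring
    have h' : ∀ z', ∑ i, ((A' *ᵥ z') i + b' i) ^ 2 + Φ (Fin.cons (σ z') z') = ∑ i, z' i ^ 2 + c := by
      intro z'
      have hz := h (Fin.cons (σ z') z')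
      rw [Fin.sum_univ_succ, Fin.sum_univ_succ, hkey] at hz
      simp only [Fin.cons_zero, Fin.cons_succ] at hz
      rw [Finset.sum_congr rfl fun i _ => by rw [hrow z' i]] at hz
      linear_combination hz
    obtain ⟨z', hz'⟩ := ih A' b' (fun z' => Φ (Fin.cons (σ z') z')) c h'
    exact ⟨Fin.cons (σ z') z', hz'⟩

/-- **Elimination lemma** over an arbitrary finite index type (transfer of `elim_fin` along `Fintype.equivFin`). -/
theorem elim_field {β : Type*} [Fintype β] (A : Matrix β β F) (b : β → F) (Φ : (β → F) → F) (c : F)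
    (h : ∀ z, ∑ i, ((A *ᵥ z) i + b i) ^ 2 + Φ z = ∑ i, z i ^ 2 + c) : ∃ z, Φ z = c := by
  classical
  set m := Fintype.card β
  let e : β ≃ Fin m := Fintype.equivFin β
  have hA : ∀ (w : Fin m → F) (i : Fin m),
      ((A.submatrix e.symm e.symm) *ᵥ w) i = (A *ᵥ (w ∘ e)) (e.symm i) := by
    intro w i
    simp only [mulVec, dotProduct, submatrix_apply, Function.comp]
    exact Fintype.sum_equiv e.symm _ _ (fun j => by simp)
  have h' : ∀ w : Fin m → F,
      ∑ i, (((A.submatrix e.symm e.symm) *ᵥ w) i + b (e.symm i)) ^ 2 + Φ (w ∘ e) = ∑ i, w i ^ 2 + c := by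
    intro w
    calc ∑ i, (((A.submatrix e.symm e.symm) *ᵥ w) i + b (e.symm i)) ^ 2 + Φ (w ∘ e)
        = ∑ i : β, ((A *ᵥ (w ∘ e)) i + b i) ^ 2 + Φ (w ∘ e) := by
          congr 1
          symm
          refine Fintype.sum_equiv e _ _ (fun x => ?_)
          rw [hA, Equiv.symm_apply_apply]
      _ = ∑ i : β, (w ∘ e) i ^ 2 + c := h _
      _ = ∑ i, w i ^ 2 + c := by
          congr 1
          exact Fintype.sum_equiv e _ _ (fun x => rfl)
  obtain ⟨w, hw⟩ := elim_fin_field m (A.submatrix e.symm e.symm) (fun i => b (e.symm i)) (fun w => Φ (w ∘ e)) c h'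
  exact ⟨w ∘ e, hw⟩

end elimination

section gram

omit [CharZero F] in
/-- `|M v|² = k |v|²` when `Mᵀ M = k·1` -/
theorem dotProduct_mulVec_self_field {m n : Type*} [Fintype m] [Fintype n] [DecidableEq n] (M : Matrix m n F) (k : F)
    (hM : Mᵀ * M = k • (1 : Matrix n n F)) (v : n → F) : (M *ᵥ v) ⬝ᵥ (M *ᵥ v) = k * (v ⬝ᵥ v) := by
  calc (M *ᵥ v) ⬝ᵥ (M *ᵥ v) = (v ᵥ* Mᵀ) ⬝ᵥ (M *ᵥ v) := by rw [vecMul_transpose]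
    _ = v ⬝ᵥ (Mᵀ *ᵥ (M *ᵥ v)) := (dotProduct_mulVec _ _ _).symm
    _ = v ⬝ᵥ ((Mᵀ * M) *ᵥ v) := by rw [mulVec_mulVec]
    _ = k * (v ⬝ᵥ v) := by rw [hM, smul_mulVec, one_mulVec, dotProduct_smul, smul_eq_mul]

/-- a natural number is a sum of four squares in any field (Lagrange, cast) -/
theorem exists_four_sq_cast (k : ℕ) : ∃ a b c d : F, a ^ 2 + b ^ 2 + c ^ 2 + d ^ 2 = (k : F) := by
  obtain ⟨a, b, c, d, h⟩ := Nat.sum_four_squares k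
  exact ⟨a, b, c, d, by exact_mod_cast h⟩

omit [CharZero F] in
/-- the quaternion matrix: `B Bᵀ = (a² + b² + c² + d²)·1` -/
theorem quaternionMatrix_mul_transpose_field (a b c d : F) :
    (!![a, b, c, d; -b, a, -d, c; -c, d, a, -b; -d, -c, b, a] : Matrix (Fin 4) (Fin 4) F) *
      (!![a, b, c, d; -b, a, -d, c; -c, d, a, -b; -d, -c, b, a] : Matrix (Fin 4) (Fin 4) F)ᵀ
      = (a ^ 2 + b ^ 2 + c ^ 2 + d ^ 2) • (1 : Matrix (Fin 4) (Fin 4) F) := by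
  ext i j
  fin_cases i <;> fin_cases j <;>
    simp [Matrix.mul_apply, Fin.sum_univ_four] <;> ring

/-- **Core case** on the index type `(Fin 4 × Fin q) ⊕ Fin 2`: `W Wᵀ = k·1`, `k = a² + b² + c² + d² ≠ 0` ⇒ `k = u² + v²`. -/
theorem sq_add_sq_of_mul_transpose_self_core_field (q : ℕ)
    (W : Matrix ((Fin 4 × Fin q) ⊕ Fin 2) ((Fin 4 × Fin q) ⊕ Fin 2) F) (k : F) (hk : k ≠ 0)
    (hW : W * Wᵀ = k • (1 : Matrix _ _ F)) (a b c d : F) (habcd : a ^ 2 + b ^ 2 + c ^ 2 + d ^ 2 = k) :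
    ∃ u v : F, u ^ 2 + v ^ 2 = k := by
  -- quaternion block and the block-diagonal substitution
  set B : Matrix (Fin 4) (Fin 4) F := !![a, b, c, d; -b, a, -d, c; -c, d, a, -b; -d, -c, b, a] with hBdef
  have hB : B * Bᵀ = k • (1 : Matrix (Fin 4) (Fin 4) F) := by
    rw [hBdef, quaternionMatrix_mul_transpose_field, habcd]
  set M : Matrix (Fin 4 × Fin q) (Fin 4 × Fin q) F := blockDiagonal (fun _ : Fin q => Bᵀ) with hMdef
  have hM : Mᵀ * M = k • (1 : Matrix _ _ F) := by
    rw [hMdef, blockDiagonal_transpose, ← blockDiagonal_mul]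
    simp only [transpose_transpose, hB]
    have e1 : (fun _ : Fin q => k • (1 : Matrix (Fin 4) (Fin 4) F)) = k • (1 : Fin q → Matrix (Fin 4) (Fin 4) F) := rfl
    rw [e1, blockDiagonal_smul, blockDiagonal_one]
  set T : Matrix ((Fin 4 × Fin q) ⊕ Fin 2) (Fin 4 × Fin q) F := fromRows (k⁻¹ • M) 0 with hTdef
  set x₀ : (Fin 4 × Fin q) ⊕ Fin 2 → F := Sum.elim 0 ![1, 0] with hx₀def
  set x : (Fin 4 × Fin q → F) → ((Fin 4 × Fin q) ⊕ Fin 2 → F) := fun z => T *ᵥ z + x₀ with hxdef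
  -- |x z|² = k⁻¹ |z|² + 1
  have hnorm : ∀ z, x z ⬝ᵥ x z = k⁻¹ * (z ⬝ᵥ z) + 1 := by
    intro z
    have hxz : x z = Sum.elim ((k⁻¹ • M) *ᵥ z) ![1, 0] := by
      simp only [hxdef, hTdef, hx₀def, fromRows_mulVec, Matrix.zero_mulVec]
      ext (j | t) <;> simp
    rw [hxz]
    simp only [dotProduct, Fintype.sum_sum_type, Sum.elim_inl, Sum.elim_inr, Fin.sum_univ_two, Matrix.cons_val_zero,
      Matrix.cons_val_one]
    have h1 : ∑ j, ((k⁻¹ • M) *ᵥ z) j * ((k⁻¹ • M) *ᵥ z) j = k⁻¹ * ∑ j, z j * z j := by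
      have h2 := dotProduct_mulVec_self_field M k hM z
      simp only [dotProduct] at h2
      simp only [smul_mulVec, Pi.smul_apply, smul_eq_mul]
      calc ∑ j, k⁻¹ * (M *ᵥ z) j * (k⁻¹ * (M *ᵥ z) j) = k⁻¹ * k⁻¹ * ∑ j, (M *ᵥ z) j * (M *ᵥ z) j := by
            rw [Finset.mul_sum]; exact Finset.sum_congr rfl fun j _ => by ring
        _ = k⁻¹ * ∑ j, z j * z j := by rw [h2]; field_simp
    rw [h1]
    ring
  -- the forms `Wᵀ (x z) = A z + bv`
  set A : Matrix ((Fin 4 × Fin q) ⊕ Fin 2) (Fin 4 × Fin q) F := Wᵀ * T with hAdef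
  set bv : (Fin 4 × Fin q) ⊕ Fin 2 → F := Wᵀ *ᵥ x₀ with hbvdef
  have hWx : ∀ z, Wᵀ *ᵥ x z = A *ᵥ z + bv := by
    intro z
    simp only [hxdef, hAdef, hbvdef, mulVec_add, mulVec_mulVec]
  have hWW : (Wᵀ)ᵀ * Wᵀ = k • (1 : Matrix _ _ F) := by rw [transpose_transpose]; exact hW
  have hid : ∀ z, ∑ i, ((A *ᵥ z) i + bv i) ^ 2 = z ⬝ᵥ z + k := by
    intro z
    have h1 : ∑ i, ((A *ᵥ z) i + bv i) ^ 2 = (Wᵀ *ᵥ x z) ⬝ᵥ (Wᵀ *ᵥ x z) := by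
      rw [hWx]; simp only [dotProduct, Pi.add_apply, pow_two]
    rw [h1, dotProduct_mulVec_self_field Wᵀ k hWW (x z), hnorm]
    field_simp
  -- split off the two extra coordinates and eliminate the `4q` variables
  set A₁ : Matrix (Fin 4 × Fin q) (Fin 4 × Fin q) F := fun j => A (Sum.inl j) with hA₁def
  set Φ : (Fin 4 × Fin q → F) → F := fun z => ∑ t : Fin 2, ((A *ᵥ z) (Sum.inr t) + bv (Sum.inr t)) ^ 2 with hΦdef
  have hel : ∀ z, ∑ j, ((A₁ *ᵥ z) j + bv (Sum.inl j)) ^ 2 + Φ z = ∑ j, z j ^ 2 + k := by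
    intro z
    have hz := hid z
    rw [Fintype.sum_sum_type] at hz
    have e2 : ∑ j, z j ^ 2 = z ⬝ᵥ z := by simp only [dotProduct, pow_two]
    rw [e2, ← hz]
    rfl
  obtain ⟨z, hzΦ⟩ := elim_field A₁ (fun j => bv (Sum.inl j)) Φ k hel
  refine ⟨(A *ᵥ z) (Sum.inr 0) + bv (Sum.inr 0), (A *ᵥ z) (Sum.inr 1) + bv (Sum.inr 1), ?_⟩
  rw [← hzΦ, hΦdef]
  simp only [Fin.sum_univ_two]

/-- **`W Wᵀ = k·I` on `4q + 2` coordinates over a field of characteristic zero ⇒ `k ∈ ℕ` is a sum of two squares IN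
THAT FIELD** (the `ℚ` case is `sq_add_sq_of_mul_transpose_self` of `GramTwoSquares`; the field of interest for the order-4
analysis of FAMILY-F12-G13 §2 is `ℚ(√2)`). -/
theorem sq_add_sq_of_mul_transpose_self_field {α : Type*} [Fintype α] [DecidableEq α] (W : Matrix α α F) (k : ℕ)
    (hW : W * Wᵀ = (k : F) • (1 : Matrix α α F)) (hα : Fintype.card α % 4 = 2) :
    ∃ u v : F, u ^ 2 + v ^ 2 = (k : F) := by
  by_cases hk : (k : F) = 0
  · exact ⟨0, 0, by rw [hk]; ring⟩
  obtain ⟨a, b, c, d, habcd⟩ := exists_four_sq_cast (F := F) k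
  set q := Fintype.card α / 4 with hq
  have hcard : Fintype.card α = Fintype.card ((Fin 4 × Fin q) ⊕ Fin 2) := by
    simp only [Fintype.card_sum, Fintype.card_prod, Fintype.card_fin]
    omega
  let e : α ≃ (Fin 4 × Fin q) ⊕ Fin 2 := Fintype.equivOfCardEq hcard
  have hW' : W.submatrix e.symm e.symm * (W.submatrix e.symm e.symm)ᵀ = (k : F) • (1 : Matrix _ _ F) := by
    rw [transpose_submatrix, submatrix_mul_equiv, hW, submatrix_smul, Pi.smul_apply, Pi.smul_apply,
      submatrix_one_equiv]
  exact sq_add_sq_of_mul_transpose_self_core_field q _ (k : F) hk hW' a b c d habcd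

end gram

section folding
variable {ι α β : Type*} [Fintype ι] [DecidableEq ι] [Fintype α] [DecidableEq α] [Fintype β]

omit [CharZero F] [DecidableEq ι] [Fintype α] in
/-- **Abstract folding identity over a field.**  If `Vᵀ V = R`, `H R Hᵀ = n • S` and `U S Uᵀ = t • 1`, then `T = U H Vᵀ`
satisfies `T Tᵀ = (n t)·1`.  (For an involution: `R = 1 + Q`, `S = 1 + P`, `t = 4` when `U P = U`, `U Uᵀ = 2`; for the
`√2`-eigenspace of `P + Pᵀ`: `R = 2 + √2 S_Q`, `S = 2 + √2 S_P`.) -/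
theorem folding_gram_field (Hq R S : Matrix ι ι F) (U : Matrix α ι F) (V : Matrix β ι F) (n t : F)
    (hV : Vᵀ * V = R) (hHR : Hq * R * Hqᵀ = n • S) (hU : U * S * Uᵀ = t • (1 : Matrix α α F)) :
    (U * Hq * Vᵀ) * (U * Hq * Vᵀ)ᵀ = (n * t) • (1 : Matrix α α F) := by
  have h1 : (U * Hq * Vᵀ)ᵀ = V * (Hqᵀ * Uᵀ) := by
    rw [transpose_mul, transpose_mul, transpose_transpose]
  rw [h1]
  calc U * Hq * Vᵀ * (V * (Hqᵀ * Uᵀ)) = U * (Hq * (Vᵀ * V) * Hqᵀ) * Uᵀ := by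
        simp only [Matrix.mul_assoc]
    _ = U * (n • S) * Uᵀ := by rw [hV, hHR]
    _ = n • (U * S * Uᵀ) := by rw [Matrix.mul_smul, Matrix.smul_mul]
    _ = (n * t) • (1 : Matrix α α F) := by rw [hU, smul_smul]

omit [DecidableEq ι] in
/-- **Folding ⇒ two squares over a field.**  Under the hypotheses of `folding_gram_field` with `t = s²`, `s ≠ 0`,
`|β| = |α| ≡ 2 (mod 4)` and `n = N ∈ ℕ`: `N = u² + v²` for some `u, v ∈ F` (`W = s⁻¹ · U H Vᵀ` reindexed). -/
theorem folding_two_squares_field (Hq R S : Matrix ι ι F) (U : Matrix α ι F) (V : Matrix β ι F) (N : ℕ) (s : F)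
    (hs : s ≠ 0) (hV : Vᵀ * V = R) (hHR : Hq * R * Hqᵀ = (N : F) • S)
    (hU : U * S * Uᵀ = (s ^ 2) • (1 : Matrix α α F)) (eβα : β ≃ α) (hα : Fintype.card α % 4 = 2) :
    ∃ u v : F, u ^ 2 + v ^ 2 = (N : F) := by
  have hT := folding_gram_field Hq R S U V (N : F) (s ^ 2) hV hHR hU
  set T : Matrix α β F := U * Hq * Vᵀ with hTdef
  set W : Matrix α α F := s⁻¹ • T.submatrix id eβα.symm with hWdef
  have hW : W * Wᵀ = (N : F) • (1 : Matrix α α F) := by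
    rw [hWdef, transpose_smul, Matrix.smul_mul, Matrix.mul_smul, smul_smul, transpose_submatrix,
      submatrix_mul_equiv, submatrix_id_id, hT, smul_smul]
    congr 1
    field_simp
  exact sq_add_sq_of_mul_transpose_self_field W N hW hα

end folding

end Summit.Ventures.DiscreteObjects.Hadamard
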